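import Summits.BirchSwinnertonDyer.BirchSwinnertonDyer.Theorems.BiquadraticEisensteinDescentHeegnerTwistCouplingInSupplyQuarticCorner
import Summits.BirchSwinnertonDyer.BirchSwinnertonDyer.Theorems.BiquadraticEisensteinDescentHeegnerTwistCouplingInSupplyRoundingPinCellData
import Literature.NumberTheory.EllipticCurves.Rank1Residual.Predicates
import Literature.NumberTheory.EllipticCurves.Rank1Residual.X11RankOneCertificates.Minimality
import HarnessLib

set_option linter.dupNamespace false -- `Summit.BirchSwinnertonDyer.BirchSwinnertonDyer.Theorems.…` (summit = sub)
set_option autoImplicit false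

/-!
# Crux `HeegnerTwistCouplingInSupply` (stmt-BirchSwinnertonDyer-21381) — ★★ the QUARTIC corner `W = X_p`, `W = X_{p³}` for EVERY prime
# `p ≡ 15 (mod 16)` (no residue-class hypothesis, no density residual), modulo Burungale–Tian ONLY; binder-free form; crux body on the family

Route `BiquadraticEisensteinDescent` (cell `pub/bsd-wall`, width seat `bsd-wall-cm-bed-w4` g14; `--supports` 21381, helper). Sequel of
`…QuarticCorner.cruxOnQuarticCorner_of_BT` (bed-w3 g12): there, for `W = X_{p^k} : y² = x³ + p^k x` (`k ∈ {1, 3}`, `j = 1728`, CM by `ℤ[i]`,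
`p ≡ 15 (mod 16)` inert and bad of Kodaira type III / III*, root number `−1`) the CONCLUSION of the crux — a Heegner field `K′` of `N(W)` with
`4 < |d_{K′}|`, `L(W^{(d_{K′})}, 1) ≠ 0`, `h(K′) < p`, `p ∤ h(K′)` — is proved modulo Burungale–Tian's rank-zero `2`-converse for CM curves, on
the classes `p ≡ 2 (mod 3) ∨ p ≡ ±2 (mod 5) ∨ (p/11) = −1 ∨ (p/19) = −1 ∨ (p/43) = −1 ∨ (13/p) = −1` (`63/64` of `p ≡ 7 (mod 8)`), because its
only `p`-dependent input, the CELL DATUM (primes `q ≡ 3`, `l ≡ 5 (mod 8)` with `(q/p) = +1`, `(l/p) = −1`, `h(−ql) < p`), took one partner from a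
fixed prime. Since then bed-w2 g13 landed `…RoundingPinCellData.exists_cellData_p_all` — the cell datum for EVERY prime `p ≡ 7 (mod 8)` (rounding
pin `|z² − 2p|` above `1400`, kernel table below). This file substitutes it:

* §1 ★★ `cruxOnQuarticCornerAllP_of_BT` — `cruxOnQuarticCorner_of_BT` with its residue-class hypothesis DELETED: EVERY prime `p ≡ 15 (mod 16)`,
  `k ∈ {1, 3}`, modulo Burungale–Tian ONLY (the descent `…QuarticCell`, the continuation `QuarticTwist.hasEntireLFunction`, the witness field
  `…PartnerLadder.exists_witnessField_of` and the support of `N(X_{p^k})` BY NAME — no Deuring–Hecke, no Monsky, no modularity);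
* §2 the crux's instance binders DISCHARGED for the literal `X_{p^k}`: `isElliptic_Xpow`, `isGloballyMinimal_Xpow` (`Δ = −64 p^{3k}`, `3k ≤ 9 < 12`
  at `p`, `2⁶` at `2`: Silverman VII.1.1 via the tree's `isGloballyMinimal_of_int_criterion`), `N ≠ 0` (`conductorNorm_pos_holds`), and
  ★★ `cruxOnQuarticCornerAllP` — an honest closed statement about `y² = x³ + p x` and `y² = x³ + p³ x` for every prime `p ≡ 15 (mod 16)`;
* §3 the crux BODY verbatim on the family: `eq_of_not_good_Xpow` (`¬ Good X_{n^k} p ∧ 5 ≤ p ⇒ p = n`), ★★ `heegnerTwistCouplingInSupply_Xpow`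
  and ★★ `heegnerTwistCouplingInSupply_of_eq_Xpow` — the universally quantified body of `HeegnerTwistCouplingInSupply` with the single extra
  hypothesis `∃ n k, n.Prime ∧ n % 16 = 15 ∧ (k = 1 ∨ k = 3) ∧ W = X_{n^k}` (shape of bed-w2 g13's `…RoundingPinCruxOnFamily`), modulo
  Burungale–Tian ONLY.

HONEST FRAMING: a typed sub-corner on ONE CM family (`j = 1728`, the quartic twists `X_p`, `X_{p³}`; `p ≡ 7 (mod 16)` has root number `+1`
and is outside the crux); the crux (all CM `W` of analytic rank one in the inert-bad corner; residual C⁺ on the tail) is untouched; BSD is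
not proved by any of this. THEOREMS ONLY (no definition, no new named fact, no `sorry`). Supports stmt-BirchSwinnertonDyer-21381.
-/

noncomputable section

open scoped Classical NumberField

namespace Summit.BirchSwinnertonDyer.BirchSwinnertonDyer.Theorems.BiquadraticEisensteinDescentHeegnerTwistCouplingInSupplyQuarticCornerAllP

open _root_.WeierstrassCurve Literature.NumberTheory.EllipticCurves Literature.NumberTheory.EllipticCurves.Rank1Residual
open Literature.NumberTheory.QuadraticFields
open Summit.BirchSwinnertonDyer.BirchSwinnertonDyer.Theorems.BiquadraticEisensteinDescentHeegnerTwistCouplingInSupplyQuarticCell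
  (isElliptic_X)
open Summit.BirchSwinnertonDyer.BirchSwinnertonDyer.Theorems.BiquadraticEisensteinDescentHeegnerTwistCouplingInSupplyQuarticCellPhiHat (b_pos)
open Summit.BirchSwinnertonDyer.BirchSwinnertonDyer.Theorems.BiquadraticEisensteinDescentHeegnerTwistCouplingInSupplyQuarticCorner
  (L_one_ne_zero_X eq_two_or_eq_of_prime_dvd_conductorNorm_X quadraticTwist_X_neg_mul hasGoodReductionAtPrime_X hasCM_Xp)
open Summit.BirchSwinnertonDyer.BirchSwinnertonDyer.Theorems.BiquadraticEisensteinDescentHeegnerTwistCouplingInSupplyPartnerLadder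
  (exists_witnessField_of jacobiSym_neg_mul_eq_one)
open Summit.BirchSwinnertonDyer.BirchSwinnertonDyer.Theorems.BiquadraticEisensteinDescentHeegnerTwistCouplingInSupplyRoundingPinCellData
  (exists_cellData_p_all)

/-! ## §1 ★★ The quartic corner for EVERY prime `p ≡ 15 (mod 16)`, modulo Burungale–Tian only -/

/-- ★★ **THE QUARTIC CORNER FOR EVERY PRIME `p ≡ 15 (mod 16)`, ONE NAMED FACT.** For every prime `p ≡ 15 (mod 16)` and `W = X_{p^k} :
y² = x³ + p^k x` with `k ∈ {1, 3}`: modulo Burungale–Tian's rank-zero `2`-converse for CM curves ONLY there is an imaginary quadratic field `K′`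
(`= ℚ(√−ql)` for the cell primes `q ≡ 3`, `l ≡ 5 (mod 8)`, `(q/p) = +1`, `(l/p) = −1` of `exists_cellData_p_all`) with `4 < |d_{K′}|`, Heegner
for `N(W)` (every prime divisor of `N(W)` is `2` or `p`; `d_{K′} ≡ 1 (mod 8)`, `(d_{K′}/p) = +1`), `L(W^{(d_{K′})}, 1) ≠ 0` (`W^{(−ql)} = X_{p^k q² l²}`:
complete `2`-isogeny descent, UNCONDITIONAL, then Burungale–Tian at the prime `2` and the PROVED continuation `QuarticTwist.hasEntireLFunction`),
`h(K′) < p` and hence `p ∤ h(K′)` — the CONCLUSION of crux 21381 for `W`. This is `…QuarticCorner.cruxOnQuarticCorner_of_BT` with its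
residue-class hypothesis DELETED. [cite: BurungaleTian2026, Thm. 1.1] [cite: SilvermanAEC2009, Prop. X.4.9 and Thm. X.4.2(a)]
[cite: Oesterle1988Gauss, II §3 Proposition p. 57 (27)] [cite: IrelandRosen1990, Ch. 18 §6 Theorem 7] -/
theorem cruxOnQuarticCornerAllP_of_BT (hBT : burungaleTian_analyticRank_eq_zero_of_selmerCorank_eq_zero_of_hasCM) :
    ∀ (p k : ℕ) [Fact p.Prime] [(⟨0, 0, 0, (p : ℚ) ^ k, 0⟩ : WeierstrassCurve ℚ).IsElliptic]
      [(⟨0, 0, 0, (p : ℚ) ^ k, 0⟩ : WeierstrassCurve ℚ).IsGloballyMinimal]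
      [NeZero ((⟨0, 0, 0, (p : ℚ) ^ k, 0⟩ : WeierstrassCurve ℚ).conductorNorm ℤ)],
      p % 16 = 15 → (k = 1 ∨ k = 3) →
      ∃ (K : Type) (_ : Field K) (_ : NumberField K),
        IsImaginaryQuadratic K ∧ 4 < (NumberField.discr K).natAbs ∧
        SatisfiesHeegnerHypothesis ((⟨0, 0, 0, (p : ℚ) ^ k, 0⟩ : WeierstrassCurve ℚ).conductorNorm ℤ) K ∧
        ((⟨0, 0, 0, (p : ℚ) ^ k, 0⟩ : WeierstrassCurve ℚ).quadraticTwist (NumberField.discr K : ℚ)).entireLFunction 1 ≠ 0 ∧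
        NumberField.classNumber K < p ∧ ¬ p ∣ NumberField.classNumber K := by
  intro p k hpF _ _ _ hp16 hk
  have hp : p.Prime := hpF.out
  obtain ⟨q, l, hq, hq8, hl, hl8, hJq, hJl, hh⟩ := exists_cellData_p_all hp (by omega)
  obtain ⟨K, iF, iN, hK, hdK, hH', hcl⟩ := exists_witnessField_of (N := (⟨0, 0, 0, (p : ℚ) ^ k, 0⟩ : WeierstrassCurve ℚ).conductorNorm ℤ)
    hq hq8 hl hl8 (jacobiSym_neg_mul_eq_one (by omega) hJq hJl) hh (fun r hr hrN => eq_two_or_eq_of_prime_dvd_conductorNorm_X hp hr hrN)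
  refine ⟨K, iF, iN, hK, ?_, hH', ?_, hcl, fun hdvd => absurd (Nat.le_of_dvd (NumberField.classNumber_pos K) hdvd) (not_le.mpr hcl)⟩
  · rw [hdK, Int.natAbs_neg, Int.natAbs_natCast]
    have h3 : 3 ≤ q := by have := hq.two_le; omega
    have h5 : 5 ≤ l := by have := hl.two_le; omega
    calc 4 < 3 * 5 := by norm_num
      _ ≤ q * l := Nat.mul_le_mul h3 h5
  · rw [hdK, quadraticTwist_X_neg_mul]
    haveI := isElliptic_X (b_pos (k := k) hp hq hl).ne'
    exact (L_one_ne_zero_X hBT hp hq hl hp16 hq8 hl8 hJq hJl hk).2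

/-! ## §2 The crux's instance binders for the literal `X_{p^k}`, and the binder-free corner -/

/-- **`X_{p^k}` is an elliptic curve** (`p` prime, any `k`: `B = p^k ≠ 0`, `…QuarticCell.isElliptic_X`). [folklore] -/
theorem isElliptic_Xpow (p k : ℕ) [Fact p.Prime] : (⟨0, 0, 0, (p : ℚ) ^ k, 0⟩ : WeierstrassCurve ℚ).IsElliptic := by
  have h := isElliptic_X (B := (p : ℤ) ^ k) (pow_ne_zero k (by exact_mod_cast (Fact.out : p.Prime).ne_zero))
  simpa only [Int.cast_pow, Int.cast_natCast] using h

open Literature.NumberTheory.EllipticCurves.Rank1Residual.X11RankOneCertificates in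
/-- **`X_{p^k}` (`p` an odd prime, `k ≤ 3`) is a global minimal model**: the integer model `[0, 0, 0, p^k, 0]` has `Δ = −64 p^{3k}` with
`ord_2 Δ = 6 < 12` and `ord_p Δ = 3k ≤ 9 < 12`, so no prime `q` has `q¹² ∣ Δ` (Silverman VII.1 Remark 1.1 at every place, VIII.8; the tree's
`isGloballyMinimal_of_int_criterion`). [cite: SilvermanAEC2009, VII.1 Remark 1.1] -/
theorem isGloballyMinimal_Xpow {p : ℕ} (hp : p.Prime) (hp2 : p ≠ 2) {k : ℕ} (hk : k ≤ 3) :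
    (⟨0, 0, 0, (p : ℚ) ^ k, 0⟩ : WeierstrassCurve ℚ).IsGloballyMinimal := by
  have h := isGloballyMinimal_of_int_criterion 0 0 0 ((p : ℤ) ^ k) 0 ?_
  · simpa only [Int.cast_zero, Int.cast_pow, Int.cast_natCast] using h
  · rintro q hq ⟨h12, -⟩
    have hΔ : discOf [0, 0, 0, (p : ℤ) ^ k, 0] = -(64 * ((p : ℤ) ^ k) ^ 3) := by
      simp only [discOf, invariants]
      ring
    rw [hΔ, dvd_neg] at h12
    have h12' : q ^ 12 ∣ 64 * p ^ (k * 3) := by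
      have := Int.natAbs_dvd_natAbs.mpr h12
      rw [pow_mul]
      simpa [Int.natAbs_mul, Int.natAbs_pow] using this
    by_cases hq2 : q = 2
    · subst hq2
      have hcop : Nat.Coprime (2 ^ 12) (p ^ (k * 3)) :=
        Nat.Coprime.pow _ _ ((Nat.coprime_primes Nat.prime_two hp).mpr (Ne.symm hp2))
      have h64 : 2 ^ 12 ∣ 64 := hcop.dvd_of_dvd_mul_right h12'
      have := Nat.le_of_dvd (by norm_num) h64
      omega
    · have hcop : Nat.Coprime (q ^ 12) 64 := by
        rw [show (64 : ℕ) = 2 ^ 6 by norm_num]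
        exact Nat.Coprime.pow _ _ ((Nat.coprime_primes hq Nat.prime_two).mpr hq2)
      have hqp : q ^ 12 ∣ p ^ (k * 3) := hcop.dvd_of_dvd_mul_left h12'
      have hq1 : q ∣ p := hq.dvd_of_dvd_pow (dvd_trans (dvd_pow_self q (by norm_num)) hqp)
      have hqeq : q = p := (Nat.prime_dvd_prime_iff_eq hq hp).mp hq1
      subst hqeq
      have := (Nat.pow_dvd_pow_iff_le_right hq.one_lt).mp hqp
      omega

/-- ★★ **The same corner with NO side binders**: for every prime `p ≡ 15 (mod 16)` and `k ∈ {1, 3}` — `X_{p^k} : y² = x³ + p^k x` being an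
elliptic curve (`isElliptic_Xpow`), a global minimal model (`isGloballyMinimal_Xpow`) with `N(X_{p^k}) ≠ 0` (`conductorNorm_pos_holds`) — modulo
Burungale–Tian ONLY there is a Heegner field `K′` of `N(X_{p^k})` with `4 < |d_{K′}|`, `L(X_{p^k}^{(d_{K′})}, 1) ≠ 0`, `h(K′) < p`, `p ∤ h(K′)`.
An honest closed statement; the crux itself (all CM `W`) is NOT claimed. [cite: BurungaleTian2026, Thm. 1.1]
[cite: Oesterle1988Gauss, II §3 Proposition p. 57 (27)] -/
theorem cruxOnQuarticCornerAllP (hBT : burungaleTian_analyticRank_eq_zero_of_selmerCorank_eq_zero_of_hasCM) :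
    ∀ (p k : ℕ) [Fact p.Prime], p % 16 = 15 → (k = 1 ∨ k = 3) →
      haveI := isElliptic_Xpow p k
      ∃ (K : Type) (_ : Field K) (_ : NumberField K),
        IsImaginaryQuadratic K ∧ 4 < (NumberField.discr K).natAbs ∧
        SatisfiesHeegnerHypothesis ((⟨0, 0, 0, (p : ℚ) ^ k, 0⟩ : WeierstrassCurve ℚ).conductorNorm ℤ) K ∧
        ((⟨0, 0, 0, (p : ℚ) ^ k, 0⟩ : WeierstrassCurve ℚ).quadraticTwist (NumberField.discr K : ℚ)).entireLFunction 1 ≠ 0 ∧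
        NumberField.classNumber K < p ∧ ¬ p ∣ NumberField.classNumber K := by
  intro p k hpF hp16 hk
  have hp : p.Prime := hpF.out
  haveI := isElliptic_Xpow p k
  haveI := isGloballyMinimal_Xpow hp (by omega) (k := k) (by omega)
  haveI : NeZero ((⟨0, 0, 0, (p : ℚ) ^ k, 0⟩ : WeierstrassCurve ℚ).conductorNorm ℤ) :=
    ⟨((⟨0, 0, 0, (p : ℚ) ^ k, 0⟩ : WeierstrassCurve ℚ).conductorNorm_pos_holds).ne'⟩
  exact cruxOnQuarticCornerAllP_of_BT hBT p k hp16 hk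

/-! ## §3 ★★ The crux body, verbatim, on the family `{X_n, X_{n³} : n prime, n ≡ 15 (mod 16)}` -/

/-- **The only bad prime `≥ 5` of `X_{n^k}` is `n`**: for a prime `n` and a prime `p ≥ 5` of bad reduction of `X_{n^k} : y² = x³ + n^k x`,
`p = n` (`X_{n^k}` has good reduction at every prime not dividing `2n`, `…QuarticCorner.hasGoodReductionAtPrime_X`).
[cite: SilvermanAEC2009, VII.5 Prop. 5.1(a)] -/
theorem eq_of_not_good_Xpow {n k p : ℕ} [Fact p.Prime] (hn : n.Prime) (h5 : 5 ≤ p)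
    (hbad : ¬ Good (⟨0, 0, 0, (n : ℚ) ^ k, 0⟩ : WeierstrassCurve ℚ) p) : p = n := by
  have hp : p.Prime := Fact.out
  by_contra hne
  refine hbad (hasGoodReductionAtPrime_X fun hdvd => ?_)
  rcases (Nat.Prime.dvd_mul hp).mp hdvd with h2 | h
  · have := (Nat.prime_dvd_prime_iff_eq hp Nat.prime_two).mp h2
    omega
  · exact hne ((Nat.prime_dvd_prime_iff_eq hp hn).mp h)

/-- ★★ **THE CRUX BODY ON `W := X_{n^k}`, `n` prime `≡ 15 (mod 16)`, `k ∈ {1, 3}`, ONE NAMED FACT.** For every prime `p` and all the crux's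
hypotheses on `(X_{n^k}, p)` (CM, analytic rank one, `5 ≤ p`, `p` CM-inert and bad, Heegner fields of `N(X_{n^k})` with `p ∤ h` beyond every
bound): a Heegner field `K′` of `N(X_{n^k})` with `4 < |d_{K′}|`, `L(X_{n^k}^{(d_{K′})}, 1) ≠ 0` and `p ∤ h(K′)` — modulo Burungale–Tian ONLY.
Only `¬ Good` and `5 ≤ p` are used (`p = n`); the rest is `cruxOnQuarticCornerAllP_of_BT`. [cite: BurungaleTian2026, Thm. 1.1]
[cite: Oesterle1988Gauss, II §3 Proposition p. 57 (27)] -/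
theorem heegnerTwistCouplingInSupply_Xpow
    (hBT : burungaleTian_analyticRank_eq_zero_of_selmerCorank_eq_zero_of_hasCM) {n k : ℕ} (hn : n.Prime) (hn16 : n % 16 = 15)
    (hk : k = 1 ∨ k = 3) :
    ∀ (p : ℕ) [Fact p.Prime] [(⟨0, 0, 0, (n : ℚ) ^ k, 0⟩ : WeierstrassCurve ℚ).IsElliptic]
      [(⟨0, 0, 0, (n : ℚ) ^ k, 0⟩ : WeierstrassCurve ℚ).IsGloballyMinimal]
      [NeZero ((⟨0, 0, 0, (n : ℚ) ^ k, 0⟩ : WeierstrassCurve ℚ).conductorNorm ℤ)],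
      (⟨0, 0, 0, (n : ℚ) ^ k, 0⟩ : WeierstrassCurve ℚ).HasCM → (⟨0, 0, 0, (n : ℚ) ^ k, 0⟩ : WeierstrassCurve ℚ).analyticRank = 1 →
      5 ≤ p → CMInert (⟨0, 0, 0, (n : ℚ) ^ k, 0⟩ : WeierstrassCurve ℚ) p → ¬ Good (⟨0, 0, 0, (n : ℚ) ^ k, 0⟩ : WeierstrassCurve ℚ) p →
      (∀ B : ℕ, ∃ (K : Type) (_ : Field K) (_ : NumberField K), IsImaginaryQuadratic K ∧ B < (NumberField.discr K).natAbs ∧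
        4 < (NumberField.discr K).natAbs ∧
        SatisfiesHeegnerHypothesis ((⟨0, 0, 0, (n : ℚ) ^ k, 0⟩ : WeierstrassCurve ℚ).conductorNorm ℤ) K ∧
        ¬ p ∣ NumberField.classNumber K) →
      ∃ (K : Type) (_ : Field K) (_ : NumberField K),
        IsImaginaryQuadratic K ∧ 4 < (NumberField.discr K).natAbs ∧
        SatisfiesHeegnerHypothesis ((⟨0, 0, 0, (n : ℚ) ^ k, 0⟩ : WeierstrassCurve ℚ).conductorNorm ℤ) K ∧
        ((⟨0, 0, 0, (n : ℚ) ^ k, 0⟩ : WeierstrassCurve ℚ).quadraticTwist (NumberField.discr K : ℚ)).entireLFunction 1 ≠ 0 ∧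
        ¬ p ∣ NumberField.classNumber K := by
  intro p _ _ _ _ _ _ h5 _ hbad _
  obtain rfl := eq_of_not_good_Xpow hn h5 hbad
  obtain ⟨K, iF, iN, hK, h4, hH, hL, -, hndvd⟩ := cruxOnQuarticCornerAllP_of_BT hBT p k hn16 hk
  exact ⟨K, iF, iN, hK, h4, hH, hL, hndvd⟩

/-- ★★ **THE CRUX BODY FOR EVERY `W` IN THE FAMILY `{X_n, X_{n³} : n prime, n ≡ 15 (mod 16)}`** — the universally quantified body of
`HeegnerTwistCouplingInSupply` with the single extra hypothesis `∃ n k, n.Prime ∧ n % 16 = 15 ∧ (k = 1 ∨ k = 3) ∧ W = X_{n^k}`, modulo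
Burungale–Tian ONLY. [cite: BurungaleTian2026, Thm. 1.1] [cite: Oesterle1988Gauss, II §3 Proposition p. 57 (27)] -/
theorem heegnerTwistCouplingInSupply_of_eq_Xpow
    (hBT : burungaleTian_analyticRank_eq_zero_of_selmerCorank_eq_zero_of_hasCM) :
    ∀ (W : WeierstrassCurve ℚ) [W.IsElliptic] [W.IsGloballyMinimal] (p : ℕ) [Fact p.Prime] [NeZero (W.conductorNorm ℤ)],
      (∃ n k : ℕ, n.Prime ∧ n % 16 = 15 ∧ (k = 1 ∨ k = 3) ∧ W = ⟨0, 0, 0, (n : ℚ) ^ k, 0⟩) →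
      W.HasCM → W.analyticRank = 1 → 5 ≤ p → CMInert W p → ¬ Good W p →
      (∀ B : ℕ, ∃ (K : Type) (_ : Field K) (_ : NumberField K), IsImaginaryQuadratic K ∧ B < (NumberField.discr K).natAbs ∧
        4 < (NumberField.discr K).natAbs ∧ SatisfiesHeegnerHypothesis (W.conductorNorm ℤ) K ∧ ¬ p ∣ NumberField.classNumber K) →
      ∃ (K : Type) (_ : Field K) (_ : NumberField K),
        IsImaginaryQuadratic K ∧ 4 < (NumberField.discr K).natAbs ∧
        SatisfiesHeegnerHypothesis (W.conductorNorm ℤ) K ∧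
        (W.quadraticTwist (NumberField.discr K : ℚ)).entireLFunction 1 ≠ 0 ∧ ¬ p ∣ NumberField.classNumber K := by
  intro W _ _ p _ _ hW hCM hr h5 hinert hbad hsupply
  obtain ⟨n, k, hn, hn16, hk, rfl⟩ := hW
  exact heegnerTwistCouplingInSupply_Xpow hBT hn hn16 hk p hCM hr h5 hinert hbad hsupply

end Summit.BirchSwinnertonDyer.BirchSwinnertonDyer.Theorems.BiquadraticEisensteinDescentHeegnerTwistCouplingInSupplyQuarticCornerAllP

end
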